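import Literature.Combinatorics.StablePolynomials.DiskStabilityPreservers
import Literature.Combinatorics.StablePolynomials.GraceWalshSzego
import HarnessLib

/-!
# The Grace–Walsh–Szegő coincidence theorem for disks (Borcea–Brändén II, Theorem 1.1 / Theorem 2.1
# with `C = 𝔻`, an open disk, or a closed disk)

J. Borcea, P. Brändén, *The Lee–Yang and Pólya–Schur programs. II.*, Comm. Pure Appl. Math. 62 (2009)
1595–1631 (arXiv:0809.3087):

> **Theorem 1.1 (Grace–Walsh–Szegö).** Let `f` be a symmetric multi-affine polynomial in `n` complex
> variables, let `C` be an open or closed circular domain, and let `ξ_1, …, ξ_n ∈ C`. Suppose further that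
> either the total degree of `f` equals `n` or `C` is convex (or both). Then there exists at least one point
> `ξ ∈ C` such that `f(ξ_1,…,ξ_n) = f(ξ,…,ξ)`.

§2, proof of Theorem 2.1: "it is enough to prove that if … `g(z_1,…,z_n) := f(z_1,…,z_1,…,z_n,…,z_n)` is
`C_1 × ⋯ × C_n`-stable then `f` is `C_1^{κ_1} × ⋯ × C_n^{κ_n}`-stable".

The tree proves this for half-planes (`GraceWalshSzego.lean`: `isUpperHalfPlaneStable_of_diagonal`,
`exists_eval_eq_eval_const_of_im_pos`, `…_of_im_affine_pos/nonneg`, …). This file adds the (convex) circular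
domains that are not half-planes — open and closed disks — by transporting the half-plane case along the
Möbius substitution `Φ_{(1ⁿ)}` of part I §6.1 (`mobiusSubst`, `DiskStabilityPreservers.lean`) with
`ψ(ζ) = (ζ-i)/(-iζ+1) : H → 𝔻`: for symmetric multi-affine `F`, `Ψ(F)(ζ) = Π_j (-iζ_j+1) F(ψ(ζ_1),…,ψ(ζ_n))` is
again symmetric and multi-affine, and its diagonal is `(-iζ+1)ⁿ F(ψ(ζ),…,ψ(ζ))`.

-- TODO(general form): Theorem 2.1 for several blocks of variables with distinct circular domains `C_i`, and
-- the non-convex circular domains (exteriors of disks, with the total-degree hypothesis).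

## Contents

* `rename_equiv_mobiusSubst`, `IsMultiAffine.mobiusSubst` — `Φ_{(1ⁿ)}` preserves symmetry and multi-affinity.
* **`isDiskStable_of_diagonal`** — symmetric multi-affine `F` with `F(t,…,t) ≠ 0` on `𝔻` is `𝔻ⁿ`-stable
  (Thm 2.1, `C = 𝔻`).
* **`exists_eval_eq_eval_const_of_norm_lt_one`** — GWS for the open unit disk;
  `exists_eval_eq_eval_const_of_mem_ball` — any open disk; `exists_eval_eq_eval_const_of_norm_le_one`,
  `exists_eval_eq_eval_const_of_mem_closedBall` — closed disks.

## References

* [BorceaBranden2009II] J. Borcea, P. Brändén, Comm. Pure Appl. Math. 62 (2009) 1595–1631, §1 Thm 1.1, §2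
  Thm 2.1.
* [BorceaBranden2009] J. Borcea, P. Brändén, Invent. Math. 177 (2009) 541–569, §2.2 Thm 2.3 (GWS), §6.1
  Lemma 6.2.
-/

noncomputable section

open MvPolynomial Finset

open Complex (I)

namespace Literature.Combinatorics.StablePolynomials

variable {σ : Type*} [Fintype σ] [DecidableEq σ]

/-! ## §1 `Φ_{(1ⁿ)}` preserves symmetry and multi-affinity -/

section Transport

omit [DecidableEq σ] in
/-- Renaming by a permutation commutes with `Φ_κ(z^m)` for constant `κ`. [cite: BorceaBranden2009II, §1 proof
of Prop. 1.3 ("`Φ_κ` commutes with permutations of the variables")] -/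
theorem rename_equiv_mobiusTerm (k : ℕ) (a b c d : ℂ) (e : Equiv.Perm σ) (m : σ → ℕ) :
    rename (⇑e) (mobiusTerm (fun _ : σ => k) a b c d m) = mobiusTerm (fun _ : σ => k) a b c d (m ∘ ⇑e.symm) := by
  rw [mobiusTerm, mobiusTerm, _root_.map_prod]
  simp only [_root_.map_mul, _root_.map_pow, _root_.map_add, rename_C, rename_X, Function.comp_apply]
  exact Fintype.prod_equiv e _ _ fun i => by rw [Equiv.symm_apply_apply]

omit [DecidableEq σ] in
/-- **`Φ_{(kⁿ)}` commutes with permutations of the variables.** [cite: BorceaBranden2009II, §1 proof of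
Prop. 1.3 ("`Φ_κ` commutes with permutations of the variables")] -/
theorem rename_equiv_mobiusSubst (k : ℕ) (a b c d : ℂ) (e : Equiv.Perm σ) (f : MvPolynomial σ ℂ) :
    rename (⇑e) (mobiusSubst (fun _ : σ => k) a b c d f) = mobiusSubst (fun _ : σ => k) a b c d (rename (⇑e) f) := by
  induction f using MvPolynomial.induction_on' with
  | monomial s r =>
    rw [rename_monomial, mobiusSubst_monomial, mobiusSubst_monomial, map_smul, rename_equiv_mobiusTerm]
    congr 2
    exact funext fun j => (Finsupp.mapDomain_equiv_apply (f := e) s j).symm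
  | add p q hp hq => rw [map_add, map_add, hp, hq, map_add, map_add]

/-- **`Φ_{(1ⁿ)}` preserves multi-affinity.** [cite: BorceaBranden2009II, §1 Lemma 1.8 ("`Φ_κ` restricts to
a bijection on `ℂ_κ[z]`", `κ = (1ⁿ)`)] -/
theorem IsMultiAffine.mobiusSubst (a b c d : ℂ) {f : MvPolynomial σ ℂ} (hf : IsMultiAffine f) :
    IsMultiAffine (StablePolynomials.mobiusSubst (fun _ : σ => 1) a b c d f) :=
  fun i => degreeOf_mobiusSubst_le (fun _ : σ => 1) a b c d hf i

end Transport

/-! ## §2 Theorem 2.1 for `C = 𝔻`: stability from the diagonal -/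

section Diagonal

/-- **Borcea–Brändén II, Theorem 2.1 for `C = 𝔻` (one block): if `F` is symmetric and multi-affine and
`F(t,…,t) ≠ 0` for `|t| < 1`, then `F` is `𝔻`-stable.** Proof: `Ψ(F)` is symmetric, multi-affine, with
diagonal `(-it+1)ⁿ F(ψ(t),…,ψ(t)) ≠ 0` on `H`, hence stable (the tree's half-plane case), and
`F(ξ) = Ψ(F)(φ(ξ)) / Π(-iφ(ξ_j)+1)`. [cite: BorceaBranden2009II, §2 Thm 2.1 and its proof (`C_i = 𝔻`)]
[cite: BorceaBranden2009, §6.1 Lemma 6.2] -/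
theorem isDiskStable_of_diagonal {F : MvPolynomial σ ℂ} (hF : IsMultiAffine F)
    (hFs : ∀ e : Equiv.Perm σ, rename (⇑e) F = F) (hst : ∀ t : ℂ, ‖t‖ < 1 → eval (fun _ : σ => t) F ≠ 0) :
    IsDiskStable F := by
  have hF1 : ∀ i, degreeOf i F ≤ (fun _ : σ => 1) i := hF
  -- `G = Ψ(F)` is stable
  have hG : IsUpperHalfPlaneStable (mobiusSubst (fun _ : σ => 1) 1 (-I) (-I) 1 F) := by
    refine isUpperHalfPlaneStable_of_diagonal (hF.mobiusSubst 1 (-I) (-I) 1)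
      (fun e => by rw [rename_equiv_mobiusSubst, hFs]) fun t ht h0 => ?_
    have h1 : ∀ _i : σ, -I * t + 1 ≠ 0 := fun _ => neg_I_mul_add_one_ne_zero ht
    rw [eval_diagonal, eval_mobiusSubst (fun _ : σ => 1) 1 (-I) (-I) 1 hF1 h1, mul_eq_zero] at h0
    rcases h0 with h0 | h0
    · exact (prod_ne_zero_iff.2 fun i _ => pow_ne_zero _ (h1 i)) h0
    · exact hst _ (norm_mobius_psi_lt_one ht) h0
  intro ξ hξ
  have h1 : ∀ i, I * ξ i + 1 ≠ 0 := fun i => I_mul_add_one_ne_zero (ne_I_of_norm_lt_one (hξ i))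
  have h2 : ∀ i, -I * mobius 1 I I 1 (ξ i) + 1 ≠ 0 := fun i =>
    neg_I_mul_add_one_ne_zero (im_mobius_phi_pos (hξ i))
  have h3 := hG (fun i => mobius 1 I I 1 (ξ i)) fun i => im_mobius_phi_pos (hξ i)
  rw [eval_mobiusSubst (fun _ : σ => 1) 1 (-I) (-I) 1 hF1 h2] at h3
  have h4 : (fun i => mobius 1 (-I) (-I) 1 (mobius 1 I I 1 (ξ i))) = ξ := funext fun i => mobius_psi_phi (h1 i)
  rw [h4] at h3
  exact (mul_ne_zero_iff.1 h3).2

end Diagonal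

/-! ## §3 Grace–Walsh–Szegő for disks -/

section GWS

/-- **The Grace–Walsh–Szegő coincidence theorem for the open unit disk**: if `f ∈ ℂ[z_σ]` is symmetric and
multi-affine and `|ξ_i| < 1` for all `i`, then `f(ξ_1,…,ξ_n) = f(ζ,…,ζ)` for some `|ζ| < 1`.
[cite: BorceaBranden2009II, §1 Thm. 1.1 (`C = 𝔻`, convex)] [cite: BorceaBranden2009, §2.2 Thm. 2.3] -/
theorem exists_eval_eq_eval_const_of_norm_lt_one {f : MvPolynomial σ ℂ} (hf : IsMultiAffine f)
    (hfs : ∀ e : Equiv.Perm σ, rename (⇑e) f = f) (ξ : σ → ℂ) (hξ : ∀ i, ‖ξ i‖ < 1) :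
    ∃ ζ : ℂ, ‖ζ‖ < 1 ∧ eval ξ f = eval (fun _ : σ => ζ) f := by
  by_contra hne
  push Not at hne
  set g : MvPolynomial σ ℂ := f - C (eval ξ f) with hg
  have hgma : IsMultiAffine g := by
    rw [hg, sub_eq_add_neg, ← C_neg]
    exact hf.add (isMultiAffine_C _)
  have hgs : ∀ e : Equiv.Perm σ, rename (⇑e) g = g := fun e => by
    rw [hg, map_sub, hfs, rename_C]
  have hst : ∀ t : ℂ, ‖t‖ < 1 → eval (fun _ : σ => t) g ≠ 0 := fun t ht h => by
    rw [hg, map_sub, eval_C, sub_eq_zero] at h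
    exact hne t ht h.symm
  have h0 : eval ξ g = 0 := by rw [hg, map_sub, eval_C, sub_self]
  exact isDiskStable_of_diagonal hgma hgs hst ξ hξ h0

/-- GWS for the open unit disk, `MvPolynomial.IsSymmetric` form. [cite: BorceaBranden2009II, §1 Thm. 1.1
(`C = 𝔻`)] -/
theorem _root_.MvPolynomial.IsSymmetric.exists_eval_eq_eval_const_of_norm_lt_one {f : MvPolynomial σ ℂ}
    (hfs : f.IsSymmetric) (hf : IsMultiAffine f) (ξ : σ → ℂ) (hξ : ∀ i, ‖ξ i‖ < 1) :
    ∃ ζ : ℂ, ‖ζ‖ < 1 ∧ eval ξ f = eval (fun _ : σ => ζ) f :=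
  StablePolynomials.exists_eval_eq_eval_const_of_norm_lt_one hf hfs ξ hξ

/-- **GWS for an arbitrary open disk** `{z : |z - c| < r}` (affine image of `𝔻`).
[cite: BorceaBranden2009II, §1 Thm. 1.1 (`C` an open disk) and Lemma 1.8] -/
theorem exists_eval_eq_eval_const_of_mem_ball {f : MvPolynomial σ ℂ} (hf : IsMultiAffine f)
    (hfs : ∀ e : Equiv.Perm σ, rename (⇑e) f = f) (c : ℂ) {r : ℝ} (hr : 0 < r) (ξ : σ → ℂ)
    (hξ : ∀ i, ‖ξ i - c‖ < r) :
    ∃ ζ : ℂ, ‖ζ - c‖ < r ∧ eval ξ f = eval (fun _ : σ => ζ) f := by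
  have hr0 : (r : ℂ) ≠ 0 := Complex.ofReal_ne_zero.2 hr.ne'
  -- `F(u) = f(r u + c)`, `u_i = (ξ_i - c)/r ∈ 𝔻`
  obtain ⟨u, hu, hval⟩ := exists_eval_eq_eval_const_of_norm_lt_one (hf.affineSubst r c)
    (fun e => by rw [rename_perm_affineSubst, hfs]) (fun i => (ξ i - c) / r) fun i => by
      rw [norm_div, Complex.norm_real, Real.norm_of_nonneg hr.le, div_lt_one hr]
      exact hξ i
  refine ⟨r * u + c, ?_, ?_⟩
  · rw [add_sub_cancel_right, norm_mul, Complex.norm_real, Real.norm_of_nonneg hr.le]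
    calc r * ‖u‖ < r * 1 := mul_lt_mul_of_pos_left hu hr
      _ = r := mul_one r
  · rw [eval_affineSubst, eval_affineSubst] at hval
    have hξ' : (fun i => (r : ℂ) * ((ξ i - c) / r) + c) = ξ := funext fun i => by
      field_simp
      ring
    rwa [hξ'] at hval

/-- **GWS for the closed unit disk**: if `|ξ_i| ≤ 1` for all `i` then `f(ξ) = f(ζ,…,ζ)` for some `|ζ| ≤ 1`
(from the open disks of radii `1 + 1/(k+1)`: the admissible `ζ` are roots of the univariate polynomial
`f(t,…,t) - f(ξ)`, a finite set unless that polynomial vanishes). [cite: BorceaBranden2009II, §1 Thm. 1.1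
(`C` a closed circular domain, convex)] -/
theorem exists_eval_eq_eval_const_of_norm_le_one {f : MvPolynomial σ ℂ} (hf : IsMultiAffine f)
    (hfs : ∀ e : Equiv.Perm σ, rename (⇑e) f = f) (ξ : σ → ℂ) (hξ : ∀ i, ‖ξ i‖ ≤ 1) :
    ∃ ζ : ℂ, ‖ζ‖ ≤ 1 ∧ eval ξ f = eval (fun _ : σ => ζ) f := by
  set d : Polynomial ℂ := diagonal (f - C (eval ξ f)) with hd
  have hroot : ∀ t : ℂ, d.eval t = 0 ↔ eval ξ f = eval (fun _ : σ => t) f := fun t => by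
    rw [hd, eval_diagonal, map_sub, eval_C, sub_eq_zero, eq_comm]
  by_cases hq : d = 0
  · exact ⟨0, by simp, (hroot 0).1 (by rw [hq, Polynomial.eval_zero])⟩
  -- for every `k`, a coincidence point in the open disk of radius `1 + 1/(k+1)`
  have hk : ∀ k : ℕ, ∃ ζ : ℂ, ‖ζ‖ < 1 + 1 / ((k : ℝ) + 1) ∧ eval ξ f = eval (fun _ : σ => ζ) f := by
    intro k
    have hrk : (0 : ℝ) < 1 + 1 / ((k : ℝ) + 1) := by positivity
    obtain ⟨ζ, hζ, h⟩ := exists_eval_eq_eval_const_of_mem_ball hf hfs 0 hrk ξ fun i => by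
      rw [sub_zero]
      exact (hξ i).trans_lt (lt_add_of_pos_right _ (by positivity))
    exact ⟨ζ, by rwa [sub_zero] at hζ, h⟩
  -- they are roots of `d ≠ 0`; take one of least modulus
  obtain ⟨ζ₀, _, h0⟩ := hk 0
  have hS : d.roots.toFinset.Nonempty :=
    ⟨ζ₀, Multiset.mem_toFinset.2 ((Polynomial.mem_roots hq).2 ((hroot ζ₀).2 h0))⟩
  obtain ⟨ρ, hρ, hmin⟩ := exists_min_image _ (fun ρ : ℂ => ‖ρ‖) hS
  refine ⟨ρ, le_of_forall_pos_lt_add fun ε hε => ?_,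
    (hroot ρ).1 ((Polynomial.mem_roots hq).1 (Multiset.mem_toFinset.1 hρ)).eq_zero⟩
  obtain ⟨k, hkε⟩ := exists_nat_one_div_lt hε
  obtain ⟨ζ, hζ, h⟩ := hk k
  have hζS : ζ ∈ d.roots.toFinset := Multiset.mem_toFinset.2 ((Polynomial.mem_roots hq).2 ((hroot ζ).2 h))
  calc ‖ρ‖ ≤ ‖ζ‖ := hmin ζ hζS
    _ < 1 + 1 / ((k : ℝ) + 1) := hζ
    _ < 1 + ε := by linarith

/-- **GWS for an arbitrary closed disk** `{z : |z - c| ≤ r}`, `r > 0`. [cite: BorceaBranden2009II, §1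
Thm. 1.1 (`C` a closed disk) and Lemma 1.8] -/
theorem exists_eval_eq_eval_const_of_mem_closedBall {f : MvPolynomial σ ℂ} (hf : IsMultiAffine f)
    (hfs : ∀ e : Equiv.Perm σ, rename (⇑e) f = f) (c : ℂ) {r : ℝ} (hr : 0 < r) (ξ : σ → ℂ)
    (hξ : ∀ i, ‖ξ i - c‖ ≤ r) :
    ∃ ζ : ℂ, ‖ζ - c‖ ≤ r ∧ eval ξ f = eval (fun _ : σ => ζ) f := by
  have hr0 : (r : ℂ) ≠ 0 := Complex.ofReal_ne_zero.2 hr.ne'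
  obtain ⟨u, hu, hval⟩ := exists_eval_eq_eval_const_of_norm_le_one (hf.affineSubst r c)
    (fun e => by rw [rename_perm_affineSubst, hfs]) (fun i => (ξ i - c) / r) fun i => by
      rw [norm_div, Complex.norm_real, Real.norm_of_nonneg hr.le, div_le_one hr]
      exact hξ i
  refine ⟨r * u + c, ?_, ?_⟩
  · rw [add_sub_cancel_right, norm_mul, Complex.norm_real, Real.norm_of_nonneg hr.le]
    calc r * ‖u‖ ≤ r * 1 := mul_le_mul_of_nonneg_left hu hr.le
      _ = r := mul_one r
  · rw [eval_affineSubst, eval_affineSubst] at hval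
    have hξ' : (fun i => (r : ℂ) * ((ξ i - c) / r) + c) = ξ := funext fun i => by
      field_simp
      ring
    rwa [hξ'] at hval

end GWS

end Literature.Combinatorics.StablePolynomials

end
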